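import Mathlib.Tactic.Linarith
import Mathlib.Tactic.Ring
import Literature.Computability.MetaComplexity.SatMatrixForm
import Literature.Computability.MetaComplexity.FregeBoundedTautology
import HarnessLib

/-!
# Short Frege proofs of the adequacy of the matrix format: `SAT_n(m, Y) ↔ φ_m(Y)`

Sibling proof file of `SatMatrixForm.lean` (definition request `satMatrixForm`, part (3): the
ADEQUACY FACT, proved). For every format `n` and every concrete matrix code `m : CNFMatrix n`, the
textbook Frege system `textbookFrege` (`Frege.lean`) proves both implications between

* `satMatrixFormAt m` = `SAT_n(m, Y)` = `⋀_{i<n} ⋁_{j<n} ((m_{i,j,⊤} ∧ y_j) ∨ (m_{i,j,⊥} ∧ ¬y_j))`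
  (the satisfiability formula with the constants of the code substituted for the block `X`,
  `subst_satMatrixForm_codeSubst`), and
* `SatMatrix.cnfForm m` = `PropForm.ofCNF ((toCNF m).relabel (yVar n))`, the clauses of the coded
  CNF `φ_m` written in the assignment block `Y`,

by proofs of CONSTANT depth (`17`) and size POLYNOMIAL in `n` (`exists_proof_impl_cnfForm_satMatrixFormAt`,
`exists_proof_impl_satMatrixFormAt_cnfForm`, `exists_proof_biimp_satMatrixFormAt_cnfForm`). This is
the evaluation of the constant cells `(⊤ ∧ y) ∨ (b ∧ ¬y) ⊣⊢ y, …` inside each row followed by the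
monotonicity of `⋁` and `⋀` — the routine "Frege systems evaluate closed subformulas and reason
about them in polynomial size" step (Buss 1987; Krajíček 1995, §9.3, Lemma 9.3.12) that the
p-boundedness argument of Pich–Santhanam (J. ACM 2026, proof of Thm. 19: "to prove a tautology
`ψ` … it suffices to check `¬SAT_n(¬ψ, C(¬ψ))`, which implies that `SAT_n(ψ, y)` and `ψ` hold")
uses to pass between `SAT_n(⌜φ⌝, y)` and `φ(y)`.

All derivations are carried out in the bounded calculus `TextbookFrege.BD D B ℓ` of
`FregeBounded.lean` (at most `ℓ` lines, each of disjunct depth `≤ D` and size `≤ B`) with the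
sequent rules of `FregeBounded.lean` / `KrajicekRamseyReduction.lean` (`axS`, `topS`, `subsetN`,
`consConjS`, `consDisjS`, `consNegConjS`, `consNegDisjS`, `negDisjListS`, `viaMemberS`,
`conjExtractS`, `conjIntroAllS`, `cutS`, `swapS`, …), reading `disjList L` as the sequent `⊢ L`.

## Proof architecture

1. Rendering: `rowAt m i = ⋁ cells`, `satMatrixFormAt m = ⋀ rows`, `cnfForm m = ⋀ cls` with
   `cls = [⋁ lits_i]_i` (`PropForm.disjs/conjs = TextbookFrege.disjList/conjList`,
   `KrajicekRamsey.ofCNF_eq_conjList`), and the size / depth facts of the pieces.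
2. Cells (constant size): `⊢ T_{ij}, ¬y_j` if `m_{i,j,⊤}`; `⊢ T_{ij}, ¬¬y_j` if `m_{i,j,⊥}`
   (`cellPosS`, `cellNegS`); `⊢ ¬T_{ij}, C_i` for every cell (`negCellS`, the constant `m_{i,j,s}`
   being `⊤` exactly when the corresponding literal is in the clause `C_i`).
3. Rows: `⊢ ¬C_i, R_i` (`negClauseRowS`, by `negDisjListS` over the literals, each literal sequent
   pushed through its cell by `viaMemberS`) and `⊢ ¬R_i, C_i` (`negRowClauseS`, by `negDisjListS`
   over the cells).
4. Conjunctions: a generic monotonicity rule `conjListMonoS` (`⊢ ¬P_k, Q_k` for all `k` gives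
   `⊢ ¬⋀P, ⋀Q`: conjunct extraction, cut, conjunction introduction), and the packaging into
   `impl`/`biimp` proofs with explicit polynomial line and size budgets.

Sources: S. R. Buss, *Polynomial size proofs of the propositional pigeonhole principle*, JSL 52
(1987) (evaluation of formulas in Frege systems); J. Krajíček, *Bounded Arithmetic, Propositional
Logic, and Complexity Theory* (1995), §4.4, §9.3 (Lemma 9.3.12); J. Pich, R. Santhanam, J. ACM 73
(2026), §3.2, Thm. 19; J. R. Shoenfield, *Mathematical Logic* (1967), §3.1 (the rules). The
bookkeeping is folklore.
-/

namespace Literature.Computability.MetaComplexity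

open Complexity Complexity.PropForm TextbookFrege SatMatrix KrajicekRamsey

-- `omega`'s certificates for the long line-count sums of this file exceed the default depth.
set_option maxRecDepth 4000

namespace SatMatrixFrege

variable {n : ℕ}

/-! ### Rendering the two sides through `disjList` / `conjList` -/

/-- `PropForm.disjs` is `TextbookFrege.disjList`. [folklore] -/
theorem disjs_eq_disjList (L : List (PropForm ℕ)) : disjs L = disjList L := by
  induction L with
  | nil => rfl
  | cons A L ih => rw [disjList_cons, ← ih]; rfl

/-- `PropForm.conjs` is `TextbookFrege.conjList`. [folklore] -/
theorem conjs_eq_conjList (L : List (PropForm ℕ)) : conjs L = conjList L := by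
  induction L with
  | nil => rfl
  | cons A L ih => rw [conjList_cons, ← ih]; rfl

/-- The cells of row `i` of `SAT_n(m, Y)`. [folklore] -/
def cells (m : CNFMatrix n) (i : Fin n) : List (PropForm ℕ) :=
  (List.finRange n).map (cellAt m i)

/-- The rows of `SAT_n(m, Y)`, rendered. [folklore] -/
def rows (m : CNFMatrix n) : List (PropForm ℕ) :=
  (List.finRange n).map fun i => disjList (cells m i)

/-- The literal formulas of clause `i` of `φ_m` over the block `Y`. [folklore] -/
def lits (m : CNFMatrix n) (i : Fin n) : List (PropForm ℕ) :=
  (Clause.relabel (yVar n) (m.rowClause i)).map litOf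

/-- The clause formulas of `φ_m` over the block `Y`, rendered. [folklore] -/
def cls (m : CNFMatrix n) : List (PropForm ℕ) :=
  (List.finRange n).map fun i => disjList (lits m i)

/-- A row of `SAT_n(m, Y)` is the list disjunction of its cells. [folklore] -/
theorem rowAt_eq (m : CNFMatrix n) (i : Fin n) : rowAt m i = disjList (cells m i) := by
  rw [rowAt, disjs_eq_disjList]; rfl

/-- `SAT_n(m, Y)` is the list conjunction of its rows. [folklore] -/
theorem satMatrixFormAt_eq (m : CNFMatrix n) : satMatrixFormAt m = conjList (rows m) := by
  rw [satMatrixFormAt, conjs_eq_conjList, rows]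
  congr 1
  exact List.map_congr_left fun i _ => rowAt_eq m i

/-- `φ_m(Y)` is the list conjunction of its rendered clauses. [folklore] -/
theorem cnfForm_eq (m : CNFMatrix n) : cnfForm m = conjList (cls m) := by
  rw [cnfForm, ofCNF_eq_conjList, cls, CNF.relabel, CNFMatrix.toCNF, List.map_map, List.map_map]
  rfl

/-- Membership in the cells of a row. [folklore] -/
theorem mem_cells_iff (m : CNFMatrix n) (i : Fin n) (A : PropForm ℕ) :
    A ∈ cells m i ↔ ∃ j : Fin n, cellAt m i j = A := by
  simp [cells, List.mem_finRange]

/-- Membership in the literal formulas of a clause: `y_j` for `m_{i,j,⊤}`, `¬y_j` for `m_{i,j,⊥}`.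
[folklore] -/
theorem mem_lits_iff (m : CNFMatrix n) (i : Fin n) (A : PropForm ℕ) :
    A ∈ lits m i ↔ ∃ j : Fin n, (m i j true = true ∧ A = var (yVar n j)) ∨
      (m i j false = true ∧ A = neg (var (yVar n j))) := by
  simp only [lits, Clause.relabel, List.map_map, List.mem_map, Function.comp_apply]
  constructor
  · rintro ⟨l, hl, rfl⟩
    obtain ⟨j, hj, hm⟩ := (CNFMatrix.mem_rowClause_iff m i l).1 hl
    refine ⟨j, ?_⟩
    rcases l with ⟨v, s⟩
    simp only at hj hm
    subst hj
    cases s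
    · right; exact ⟨hm, by simp [litOf, Literal.relabel]⟩
    · left; exact ⟨hm, by simp [litOf, Literal.relabel]⟩
  · rintro ⟨j, ⟨hm, rfl⟩ | ⟨hm, rfl⟩⟩
    · exact ⟨((j : ℕ), true), (CNFMatrix.mem_rowClause_iff m i _).2 ⟨j, rfl, hm⟩,
        by simp [litOf, Literal.relabel]⟩
    · exact ⟨((j : ℕ), false), (CNFMatrix.mem_rowClause_iff m i _).2 ⟨j, rfl, hm⟩,
        by simp [litOf, Literal.relabel]⟩

/-- The positive literal of a cell with `m_{i,j,⊤}` is in the clause. [folklore] -/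
theorem var_mem_lits {m : CNFMatrix n} {i j : Fin n} (h : m i j true = true) :
    var (yVar n j) ∈ lits m i :=
  (mem_lits_iff m i _).2 ⟨j, Or.inl ⟨h, rfl⟩⟩

/-- The negative literal of a cell with `m_{i,j,⊥}` is in the clause. [folklore] -/
theorem neg_var_mem_lits {m : CNFMatrix n} {i j : Fin n} (h : m i j false = true) :
    neg (var (yVar n j)) ∈ lits m i :=
  (mem_lits_iff m i _).2 ⟨j, Or.inr ⟨h, rfl⟩⟩

/-! ### Size and depth of the pieces -/

/-- A cell has size `8`. [folklore] -/
@[simp] theorem size_cellAt (m : CNFMatrix n) (i j : Fin n) : (cellAt m i j).size = 8 := by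
  simp [cellAt, size]

/-- A cell has disjunct depth `2`. [folklore] -/
@[simp] theorem dd_cellAt (m : CNFMatrix n) (i j : Fin n) : (cellAt m i j).dd = 2 := by
  simp [cellAt, dd_disj, dd_conj]

/-- A negated cell has disjunct depth `4`. [folklore] -/
@[simp] theorem dd_neg_cellAt (m : CNFMatrix n) (i j : Fin n) : (neg (cellAt m i j)).dd = 4 := by
  simp [cellAt, dd_neg, altDepthAux_one_disj, dd_conj]

/-- Sum of a constant over a list. [folklore] -/
private theorem sum_map_const_nat {α : Type} (l : List α) (c : ℕ) :
    (l.map fun _ => c).sum = l.length * c := by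
  induction l with
  | nil => simp
  | cons a l ih => simp only [List.map_cons, List.sum_cons, List.length_cons, ih]; ring

/-- The cells of a row have member sum `9n`. [folklore] -/
theorem msum_cells (m : CNFMatrix n) (i : Fin n) : msum (cells m i) = 9 * n := by
  rw [msum, cells, List.map_map]
  simp only [Function.comp_def, size_cellAt, sum_map_const_nat, List.length_finRange]
  ring

/-- There are `n` cells in a row. [folklore] -/
@[simp] theorem length_cells (m : CNFMatrix n) (i : Fin n) : (cells m i).length = n := by
  simp [cells]

/-- There are `n` rows. [folklore] -/
@[simp] theorem length_rows (m : CNFMatrix n) : (rows m).length = n := by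
  simp [rows]

/-- There are `n` clauses. [folklore] -/
@[simp] theorem length_cls (m : CNFMatrix n) : (cls m).length = n := by
  simp [cls]

/-- The rows have member sum `n (9n + 2)`. [folklore] -/
theorem msum_rows (m : CNFMatrix n) : msum (rows m) = n * (9 * n + 2) := by
  rw [msum, rows, List.map_map]
  have : ((fun A : PropForm ℕ => A.size + 1) ∘ fun i : Fin n => disjList (cells m i)) =
      fun _ => 9 * n + 2 := by
    funext i
    simp only [Function.comp_apply, size_disjList_eq_msum, msum_cells]
  rw [this, sum_map_const_nat, List.length_finRange]

/-- Length of a `flatMap` with blocks of bounded length. [folklore] -/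
private theorem length_flatMap_le {α β : Type} (l : List α) (f : α → List β) (k : ℕ)
    (h : ∀ a ∈ l, (f a).length ≤ k) : (l.flatMap f).length ≤ l.length * k := by
  induction l with
  | nil => simp
  | cons a l ih =>
    rw [List.flatMap_cons, List.length_append, List.length_cons]
    have h1 := h a List.mem_cons_self
    have h2 := ih fun b hb => h b (List.mem_cons_of_mem _ hb)
    nlinarith

/-- A clause of `φ_m` has at most `2n` literals. [folklore] -/
theorem length_lits_le (m : CNFMatrix n) (i : Fin n) : (lits m i).length ≤ 2 * n := by
  rw [lits, List.length_map, Clause.relabel, List.length_map, CNFMatrix.rowClause]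
  refine (length_flatMap_le _ _ 2 fun j _ => ?_).trans (by rw [List.length_finRange]; omega)
  unfold CNFMatrix.cellLits
  split_ifs <;> simp

/-- Member sums are bounded by a uniform bound on the members. [folklore] -/
private theorem msum_le_of_forall_le (L : List (PropForm ℕ)) (k : ℕ)
    (h : ∀ A ∈ L, A.size + 1 ≤ k) : msum L ≤ L.length * k := by
  induction L with
  | nil => simp
  | cons A L ih =>
    rw [msum_cons, List.length_cons]
    have h1 := h A List.mem_cons_self
    have h2 := ih fun X hX => h X (List.mem_cons_of_mem _ hX)
    nlinarith

/-- Literal formulas have size at most `2`. [folklore] -/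
theorem size_le_of_mem_lits {m : CNFMatrix n} {i : Fin n} {A : PropForm ℕ} (hA : A ∈ lits m i) :
    A.size ≤ 2 := by
  obtain ⟨j, ⟨-, rfl⟩ | ⟨-, rfl⟩⟩ := (mem_lits_iff m i A).1 hA <;> simp [size]

/-- Literal formulas have disjunct depth at most `1`. [folklore] -/
theorem dd_le_of_mem_lits {m : CNFMatrix n} {i : Fin n} {A : PropForm ℕ} (hA : A ∈ lits m i) :
    A.dd ≤ 1 := by
  obtain ⟨j, ⟨-, rfl⟩ | ⟨-, rfl⟩⟩ := (mem_lits_iff m i A).1 hA <;> simp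

/-- The literal formulas of a clause have member sum at most `6n`. [folklore] -/
theorem msum_lits_le (m : CNFMatrix n) (i : Fin n) : msum (lits m i) ≤ 6 * n := by
  have h1 := msum_le_of_forall_le (lits m i) 3 fun A hA => by
    have := size_le_of_mem_lits hA; omega
  have h2 := length_lits_le m i
  nlinarith

/-- The rendered clauses have member sum at most `n (6n + 2)`. [folklore] -/
theorem msum_cls_le (m : CNFMatrix n) : msum (cls m) ≤ n * (6 * n + 2) := by
  have h1 := msum_le_of_forall_le (cls m) (6 * n + 2) fun A hA => by
    obtain ⟨i, -, rfl⟩ := List.mem_map.1 hA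
    rw [size_disjList_eq_msum]
    have := msum_lits_le m i; omega
  rwa [length_cls] at h1

/-- Cells have disjunct depth `≤ 2` (membership form). [folklore] -/
theorem dd_le_of_mem_cells {m : CNFMatrix n} {i : Fin n} {A : PropForm ℕ} (hA : A ∈ cells m i) :
    A.dd ≤ 2 := by
  obtain ⟨j, rfl⟩ := (mem_cells_iff m i A).1 hA; simp

/-- A row has disjunct depth `≤ 2`. [folklore] -/
theorem dd_row_le (m : CNFMatrix n) (i : Fin n) : (disjList (cells m i)).dd ≤ 2 :=
  dd_disjList_le fun _ hA => dd_le_of_mem_cells hA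

/-- A rendered clause has disjunct depth `≤ 1`. [folklore] -/
theorem dd_clause_le (m : CNFMatrix n) (i : Fin n) : (disjList (lits m i)).dd ≤ 1 :=
  dd_disjList_le fun _ hA => dd_le_of_mem_lits hA

/-- A row has size `9n + 1`. [folklore] -/
theorem size_row (m : CNFMatrix n) (i : Fin n) : (disjList (cells m i)).size = 9 * n + 1 := by
  rw [size_disjList_eq_msum, msum_cells]

/-- A rendered clause has size `≤ 6n + 1`. [folklore] -/
theorem size_clause_le (m : CNFMatrix n) (i : Fin n) : (disjList (lits m i)).size ≤ 6 * n + 1 := by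
  rw [size_disjList_eq_msum]; have := msum_lits_le m i; omega

/-! ### Cells -/

-- Side conditions on the small explicit formulas of this section are closed uniformly by
-- `simp` / `simp; omega`, with the size function and the cells unfolded by `simp`.
attribute [local simp] PropForm.size SatMatrix.cellAt

variable {D B : ℕ}

/-- Depths of the members of an explicit three-element list. [folklore] -/
private theorem dd_mem_three {X P Q R : PropForm ℕ} {p : ℕ} (hX : X ∈ [P, Q, R]) (hP : P.dd ≤ p)
    (hQ : Q.dd ≤ p) (hR : R.dd ≤ p) : X.dd ≤ p := by
  simp only [List.mem_cons, List.not_mem_nil, or_false] at hX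
  rcases hX with rfl | rfl | rfl <;> assumption

/-- **Positive cell**: if `m_{i,j,⊤}` then `⊢ T_{ij}, ¬y_j` (`2000` lines). [folklore] -/
theorem cellPosS (m : CNFMatrix n) (i j : Fin n) (h : m i j true = true) (hD : 16 ≤ D)
    (hB : 200 ≤ B) : BD D B 2000 (disjList [cellAt m i j, neg (var (yVar n j))]) := by
  have hT : cellAt m i j = disj (conj (const true) (var (yVar n j)))
      (conj (const (m i j false)) (neg (var (yVar n j)))) := by
    simp [cellAt, h]
  rw [hT]
  -- `⊢ ⊤`, weakened to `⊢ ⊤, b ∧ ¬y, ¬y`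
  have h1 : BD D B 4 (disjList [const true]) := topS (by omega) (by omega)
  have h2 : BD D B (4 + 50 * (3 + 1) ^ 2) (disjList
      [const true, conj (const (m i j false)) (neg (var (yVar n j))), neg (var (yVar n j))]) :=
    subsetN (N := 3) (p := 2) h1 (by simp) (fun X hX =>
      dd_mem_three hX (by simp) (by simp) (by simp)) (by omega)
      (by simp; omega) (by simp) (by simp)
  -- `⊢ ¬y, y`, weakened to `⊢ y, b ∧ ¬y, ¬y`
  have h3 : BD D B 12 (disjList [neg (var (yVar n j)), var (yVar n j)]) :=
    axS _ (by simp; omega) (by simp; omega)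
  have h4 : BD D B (12 + 50 * (3 + 1) ^ 2) (disjList
      [var (yVar n j), conj (const (m i j false)) (neg (var (yVar n j))), neg (var (yVar n j))]) :=
    subsetN (N := 3) (p := 2) h3 (fun X hX => by
      simp only [List.mem_cons, List.not_mem_nil, or_false] at hX ⊢; tauto) (fun X hX =>
      dd_mem_three hX (by simp) (by simp) (by simp)) (by omega)
      (by simp; omega) (by simp) (by simp)
  -- `⊢ ⊤ ∧ y, b ∧ ¬y, ¬y`, then `⊢ (⊤ ∧ y) ∨ (b ∧ ¬y), ¬y`
  have h5 := consConjS h2 h4 (by simp; omega) (by simp; omega) (by simp; omega) (by simp; omega)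
  exact (consDisjS h5).mono (by norm_num)

/-- **Negative cell**: if `m_{i,j,⊥}` then `⊢ T_{ij}, ¬¬y_j` (`3000` lines). [folklore] -/
theorem cellNegS (m : CNFMatrix n) (i j : Fin n) (h : m i j false = true) (hD : 16 ≤ D)
    (hB : 200 ≤ B) : BD D B 3000 (disjList [cellAt m i j, neg (neg (var (yVar n j)))]) := by
  have hT : cellAt m i j = disj (conj (const (m i j true)) (var (yVar n j)))
      (conj (const true) (neg (var (yVar n j)))) := by
    simp [cellAt, h]
  rw [hT]
  -- `⊢ ⊤, ¬¬y, a ∧ y`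
  have h1 : BD D B 4 (disjList [const true]) := topS (by omega) (by omega)
  have h2 : BD D B (4 + 50 * (3 + 1) ^ 2) (disjList
      [const true, neg (neg (var (yVar n j))), conj (const (m i j true)) (var (yVar n j))]) :=
    subsetN (N := 3) (p := 2) h1 (by simp) (fun X hX =>
      dd_mem_three hX (by simp) (by simp) (by simp)) (by omega)
      (by simp; omega) (by simp) (by simp)
  -- `⊢ ¬¬y, ¬y`, weakened to `⊢ ¬y, ¬¬y, a ∧ y`
  have h3 : BD D B 12 (disjList [neg (neg (var (yVar n j))), neg (var (yVar n j))]) :=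
    axS _ (by simp; omega) (by simp; omega)
  have h4 : BD D B (12 + 50 * (3 + 1) ^ 2) (disjList
      [neg (var (yVar n j)), neg (neg (var (yVar n j))), conj (const (m i j true)) (var (yVar n j))]) :=
    subsetN (N := 3) (p := 2) h3 (fun X hX => by
      simp only [List.mem_cons, List.not_mem_nil, or_false] at hX ⊢; tauto) (fun X hX =>
      dd_mem_three hX (by simp) (by simp) (by simp)) (by omega)
      (by simp; omega) (by simp) (by simp)
  -- `⊢ ⊤ ∧ ¬y, ¬¬y, a ∧ y`
  have h5 := consConjS h2 h4 (by simp; omega) (by simp; omega) (by simp; omega) (by simp; omega)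
  -- `⊢ a ∧ y, ⊤ ∧ ¬y, ¬¬y`
  have h6 : BD D B (4 + 50 * (3 + 1) ^ 2 + (12 + 50 * (3 + 1) ^ 2) + 51 + 50 * (3 + 1) ^ 2)
      (disjList [conj (const (m i j true)) (var (yVar n j)),
        conj (const true) (neg (var (yVar n j))), neg (neg (var (yVar n j)))]) :=
    subsetN (N := 3) (p := 2) h5 (fun X hX => by
      simp only [List.mem_cons, List.not_mem_nil, or_false] at hX ⊢; tauto) (fun X hX =>
      dd_mem_three hX (by simp) (by simp) (by simp)) (by omega)
      (by simp; omega) (by simp) (by simp)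
  exact (consDisjS h6).mono (by norm_num)

/-- **A guarded literal against the clause**: `⊢ ¬(m_{i,j,s}), ¬ℓ, C_i` where `ℓ` is the literal
guarded by the constant (`y_j` for `s = ⊤`, `¬y_j` for `s = ⊥`): if the guard is `⊥` this is the
axiom `¬⊥`, weakened; if it is `⊤` the literal is a member of `C_i` (`≤ 400 (2n+5)³ + 1300` lines).
[folklore] -/
theorem guardS (m : CNFMatrix n) (i j : Fin n) (s : Bool) (hD : 16 ≤ D) (hB : 100 * n + 300 ≤ B) :
    BD D B (400 * (2 * n + 5) ^ 3 + 1300) (disjList [neg (const (m i j s)),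
      neg (if s then var (yVar n j) else neg (var (yVar n j))), disjList (lits m i)]) := by
  have hCl : (lits m i).length ≤ 2 * n := length_lits_le m i
  have hCm : msum (lits m i) ≤ 6 * n := msum_lits_le m i
  have hCd : ∀ X ∈ lits m i, X.dd ≤ 1 := fun X hX => dd_le_of_mem_lits hX
  have hCdd : (disjList (lits m i)).dd ≤ 1 := dd_clause_le m i
  have hCs : (disjList (lits m i)).size ≤ 6 * n + 1 := size_clause_le m i
  -- the guarded literal `A` and the facts about it
  generalize hA : (if s then var (yVar n j) else neg (var (yVar n j))) = A
  have hAd : A.dd ≤ 1 := by subst hA; cases s <;> simp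
  have hnAd : (neg A).dd ≤ 1 := by subst hA; cases s <;> simp
  have hAs : A.size ≤ 2 := by subst hA; cases s <;> simp [size]
  have ha1 := altDepthAux_le_dd_succ 1 (neg A)
  cases hm : m i j s
  · -- guard `⊥`: `⊢ ¬⊥`, weakened
    have h1 : BD D B (1 + 3) (disjList [neg (const false)]) :=
      unitS (negBotB (by omega) (by omega)) (by omega) (by simp; omega)
    refine (subsetN (N := 3) (p := 2) (L' := [neg (const false), neg A, disjList (lits m i)]) h1
      (by simp) (fun X hX => dd_mem_three hX (by simp) (by omega) (by omega)) (by omega)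
      ?_ (by simp) (by simp)).mono (by norm_num)
    simp only [size_disjList_cons, size_disjList_nil, size]; omega
  · -- guard `⊤`: `A ∈ C_i`, and `⊢ ¬A, A` is pushed through the member `A`
    have hAC : A ∈ lits m i := by
      subst hA; cases s
      · simpa using neg_var_mem_lits (m := m) hm
      · simpa using var_mem_lits (m := m) hm
    have h1 : BD D B 12 (disjList [neg A, A]) := axS A (by omega) (by omega)
    have h2 : BD D B (12 + 450) (disjList [A, neg A]) :=
      swapS (p := 1) h1 hnAd hAd (by omega) (by simp only [size]; omega)
    -- `⊢ ¬A, ⋁C`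
    have h3 : BD D B (12 + 450 + 400 * (2 * n + 4 + 1) ^ 3) (disjList [neg A, disjList (lits m i)]) :=
      viaMemberS (p := 1) (N := 2 * n + 4) h2 hAC (fun X hX => by
        simp only [List.mem_cons] at hX
        rcases hX with rfl | rfl | rfl | hX
        · exact hAd
        · exact hnAd
        · exact hnAd
        · exact hCd X hX) (by omega) (by omega) (by simp only [size]; omega)
    have e : (2 * n + 4 + 1) ^ 3 = (2 * n + 5) ^ 3 := by ring
    rw [e] at h3
    have hs : 2 * (disjList [neg A, disjList (lits m i)]).size +
        4 * (disjList [neg (const true), neg A, disjList (lits m i)]).size + 8 ≤ B := by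
      simp only [size_disjList_cons, size_disjList_nil, size]; omega
    have h4 := subsetN (N := 3) (p := 2) (L' := [neg (const true), neg A, disjList (lits m i)]) h3
      (fun X hX => by simp only [List.mem_cons, List.not_mem_nil, or_false] at hX ⊢; tauto)
      (fun X hX => dd_mem_three hX (by simp) (by omega) (by omega)) (by omega) hs (by simp)
      (by simp)
    exact h4.mono (by omega)

/-- **Negated cell against its clause**: `⊢ ¬T_{ij}, C_i` for every cell of row `i`
(`≤ 800 (2n+5)³ + 3000` lines). [folklore] -/
theorem negCellS (m : CNFMatrix n) (i j : Fin n) (hD : 16 ≤ D) (hB : 100 * n + 300 ≤ B) :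
    BD D B (800 * (2 * n + 5) ^ 3 + 3000)
      (disjList [neg (cellAt m i j), disjList (lits m i)]) := by
  have hCdd : (disjList (lits m i)).dd ≤ 1 := dd_clause_le m i
  have hCs : (disjList (lits m i)).size ≤ 6 * n + 1 := size_clause_le m i
  have hA := guardS m i j true hD hB
  have hB' := guardS m i j false hD hB
  simp only [ite_true] at hA
  simp only [Bool.false_eq_true, ite_false] at hB'
  -- `⊢ ¬(a ∧ y), C` and `⊢ ¬(b ∧ ¬y), C`
  have h1 : BD D B (400 * (2 * n + 5) ^ 3 + 1300 + 7)
      (disjList [neg (conj (const (m i j true)) (var (yVar n j))), disjList (lits m i)]) :=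
    consNegConjS hA (by simp; omega) (by simp; omega)
      (by rw [disjList_cons, disjList_nil, dd_neg, altDepthAux_one_disj, dd_const]; omega)
      (by simp only [size_disjList_cons, size_disjList_nil, size]; omega)
  have h2 : BD D B (400 * (2 * n + 5) ^ 3 + 1300 + 7)
      (disjList [neg (conj (const (m i j false)) (neg (var (yVar n j)))), disjList (lits m i)]) :=
    consNegConjS hB' (by simp; omega) (by simp; omega)
      (by rw [disjList_cons, disjList_nil, dd_neg, altDepthAux_one_disj, dd_const]; omega)
      (by simp only [size_disjList_cons, size_disjList_nil, size]; omega)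
  have h3 := consNegDisjS h1 h2 (by simp; omega) (by simp; omega)
    (by rw [disjList_cons, disjList_nil, dd_disj, dd_const]; omega)
    (by simp only [size_disjList_cons, size_disjList_nil, size]; omega)
  exact h3.mono (by omega)

/-! ### Rows -/

/-- A cell belongs to the cells of its row. [folklore] -/
theorem cellAt_mem_cells (m : CNFMatrix n) (i j : Fin n) : cellAt m i j ∈ cells m i :=
  (mem_cells_iff m i _).2 ⟨j, rfl⟩

/-- Line budget of `⊢ ¬C_i, R_i`. [folklore] -/
def clauseRowLines (n : ℕ) : ℕ :=
  4 + 2 * n * (3000 + 400 * (n + 4 + 1) ^ 3 + 35)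

/-- Line budget of `⊢ ¬R_i, C_i`. [folklore] -/
def rowClauseLines (n : ℕ) : ℕ :=
  4 + n * (800 * (2 * n + 5) ^ 3 + 3000 + 35)

/-- **A literal through its cell**: for a literal `ℓ` of `C_i`, `⊢ ¬ℓ, R_i` (the cell guarding `ℓ`
has guard `⊤`, so `⊢ T, ¬ℓ`, and `T` is a member of `R_i`). [folklore] -/
theorem negLitRowS (m : CNFMatrix n) (i : Fin n) {z : PropForm ℕ} (hz : z ∈ lits m i) (hD : 16 ≤ D)
    (hB : 100 * n + 300 ≤ B) :
    BD D B (3000 + 400 * (n + 4 + 1) ^ 3) (disjList [neg z, disjList (cells m i)]) := by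
  have hdd : ∀ (j : Fin n) (Y : PropForm ℕ), Y.dd ≤ 1 →
      ∀ X ∈ cellAt m i j :: Y :: neg (cellAt m i j) :: cells m i, X.dd ≤ 4 := by
    intro j Y hY X hX
    simp only [List.mem_cons] at hX
    rcases hX with rfl | rfl | rfl | hX
    · simp
    · omega
    · exact (dd_neg_cellAt m i j).le
    · exact (dd_le_of_mem_cells hX).trans (by norm_num)
  obtain ⟨j, ⟨hm, rfl⟩ | ⟨hm, rfl⟩⟩ := (mem_lits_iff m i z).1 hz
  · have h1 := (cellPosS (D := D) (B := B) m i j hm hD (by omega)).mono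
      (show 2000 ≤ 3000 by norm_num)
    exact viaMemberS (p := 4) (N := n + 4) h1 (cellAt_mem_cells m i j) (hdd j _ (by simp))
      (by omega) (by rw [length_cells]) (by rw [msum_cells, size_cellAt]; simp only [size]; omega)
  · have h1 := cellNegS (D := D) (B := B) m i j hm hD (by omega)
    exact viaMemberS (p := 4) (N := n + 4) h1 (cellAt_mem_cells m i j) (hdd j _ (by simp))
      (by omega) (by rw [length_cells]) (by rw [msum_cells, size_cellAt]; simp only [size]; omega)

/-- **Clause against row**: `⊢ ¬C_i, R_i` (`clauseRowLines n` lines). [folklore] -/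
theorem negClauseRowS (m : CNFMatrix n) (i : Fin n) (hD : 16 ≤ D) (hB : 100 * n + 300 ≤ B) :
    BD D B (clauseRowLines n) (disjList [neg (disjList (lits m i)), disjList (cells m i)]) := by
  have hr := dd_row_le m i
  have hc := size_clause_le m i
  have hrs := size_row m i
  have h := negDisjListS (lits m i) (L := [disjList (cells m i)]) (p := 2)
    (fun z hz => negLitRowS m i hz hD hB) (fun z hz => (dd_le_of_mem_lits hz).trans (by norm_num))
    (by rw [disjList_cons, disjList_nil, dd_disj, dd_const]; omega) (by omega)
    (by simp only [size_disjList_cons, size_disjList_nil]; omega)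
  unfold clauseRowLines
  refine h.mono ?_
  have := Nat.mul_le_mul_right (3000 + 400 * (n + 4 + 1) ^ 3 + 35) (length_lits_le m i)
  omega

/-- **Row against clause**: `⊢ ¬R_i, C_i` (`rowClauseLines n` lines). [folklore] -/
theorem negRowClauseS (m : CNFMatrix n) (i : Fin n) (hD : 16 ≤ D) (hB : 100 * n + 300 ≤ B) :
    BD D B (rowClauseLines n) (disjList [neg (disjList (cells m i)), disjList (lits m i)]) := by
  have hr := dd_clause_le m i
  have hc := size_clause_le m i
  have hrs := size_row m i
  have h := negDisjListS (cells m i) (L := [disjList (lits m i)]) (p := 2)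
    (fun z hz => by
      obtain ⟨j, rfl⟩ := (mem_cells_iff m i z).1 hz
      exact negCellS m i j hD hB)
    (fun z hz => dd_le_of_mem_cells hz)
    (by rw [disjList_cons, disjList_nil, dd_disj, dd_const]; omega) (by omega)
    (by simp only [size_disjList_cons, size_disjList_nil]; omega)
  unfold rowClauseLines
  rw [length_cells] at h
  exact h

/-! ### Conjunctions: monotonicity of `⋀` along a list -/

/-- **Monotonicity of `⋀`**: if every member `Q` of `Qs` comes with a member `P` of `Ps` and a
derivation of `⊢ ¬P, Q`, then `⊢ ¬⋀Ps, ⋀Qs` (for each `Q`: conjunct extraction `⊢ ¬⋀Ps, P`, cut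
against `⊢ ¬P, Q`; then conjunction introduction over `Qs`). [Shoenfield 1967, §3.1] [folklore] -/
theorem conjListMonoS (Ps Qs : List (PropForm ℕ)) {m₀ p : ℕ}
    (h : ∀ Q ∈ Qs, ∃ P ∈ Ps, BD D B m₀ (disjList [neg P, Q]))
    (hp : ∀ X ∈ Ps ++ Qs, X.dd ≤ p) (hD : p + 11 ≤ D) (hs : 16 * (msum Ps + msum Qs) + 200 ≤ B) :
    BD D B (Qs.length * (m₀ + 126 * Ps.length + 2514 + 51) + 2254)
      (disjList [neg (conjList Ps), conjList Qs]) := by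
  have hpP : ∀ X ∈ Ps, X.dd ≤ p := fun X hX => hp X (List.mem_append_left _ hX)
  have hpQ : ∀ X ∈ Qs, X.dd ≤ p := fun X hX => hp X (List.mem_append_right _ hX)
  have hncP : (neg (conjList Ps)).dd ≤ p + 3 := dd_neg_conjList_le hpP
  have hcQ : (conjList Qs).dd ≤ p + 2 := dd_conjList_le hpQ
  have hszP : (conjList Ps).size = msum Ps + 1 := size_conjList_eq_msum Ps
  have hszQ : (conjList Qs).size = msum Qs + 1 := size_conjList_eq_msum Qs
  -- each `⊢ Q, ¬⋀Ps`
  have step : ∀ Q ∈ Qs, BD D B (m₀ + 126 * Ps.length + 2514) (disjList [Q, neg (conjList Ps)]) := by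
    intro Q hQ
    obtain ⟨P, hP, hPQ⟩ := h Q hQ
    have hPs : P.size < msum Ps := size_lt_msum hP
    have hQs : Q.size < msum Qs := size_lt_msum hQ
    have hdP := hpP P hP
    have hdQ := hpQ Q hQ
    have hdnP : (neg P).dd ≤ p + 2 := by
      have := altDepthAux_le_dd_succ 1 P; rw [dd_neg]; omega
    -- `⊢ ¬⋀Ps, P`, `⊢ P, ¬⋀Ps`, `⊢ P, ¬⋀Ps, Q`
    have e1 : BD D B (12 + 126 * Ps.length) (disjList [neg (conjList Ps), P]) :=
      conjExtractS hP hpP (by omega) (by rw [hszP]; omega)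
    have e2 : BD D B (12 + 126 * Ps.length + 450) (disjList [P, neg (conjList Ps)]) :=
      swapS (p := p + 3) e1 hncP (hdP.trans (by omega)) (by omega) (by simp only [size]; omega)
    have e3 : BD D B (12 + 126 * Ps.length + 450 + 800) (disjList [P, neg (conjList Ps), Q]) :=
      appendS (p := p + 3) e2 (hdP.trans (by omega)) (hdQ.trans (by omega)) hncP (by omega)
        (by simp only [size]; omega)
    -- `⊢ ¬P, ¬⋀Ps, Q`
    have f2 : BD D B (m₀ + 800) (disjList [neg P, neg (conjList Ps), Q]) :=
      insertMidS (p := p + 3) hPQ (hdnP.trans (by omega)) (hdQ.trans (by omega)) hncP (by omega)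
        (by simp only [size]; omega)
    -- cut, then `⊢ Q, ¬⋀Ps`
    have g : BD D B (12 + 126 * Ps.length + 450 + 800 + (m₀ + 800) + 2)
        (disjList [neg (conjList Ps), Q]) :=
      cutS e3 f2 (by simp only [size_disjList_cons, size_disjList_nil, size]; omega)
    exact (swapS (p := p + 3) g hncP (hdQ.trans (by omega)) (by omega)
      (by simp only [size]; omega)).mono (by omega)
  -- `⊢ ⋀Qs, ¬⋀Ps`
  have hall := conjIntroAllS (L := [neg (conjList Ps)]) (N := 5) (p := p + 3) Qs step
    (fun X hX => by
      rcases List.mem_append.1 hX with hX | hX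
      · exact (hpQ X hX).trans (by omega)
      · rw [List.mem_singleton.1 hX]; exact hncP) (by omega) (by simp)
    (by simp only [msum_append, msum_cons, msum_nil, size]; omega)
  have fin := swapS (p := p + 3) hall (hcQ.trans (by omega)) hncP (by omega)
    (by simp only [size]; omega)
  exact fin.mono (by norm_num; omega)

/-! ### The two implications as sequents -/

/-- `⊢ ¬φ_m(Y), SAT_n(m, Y)`. [folklore] -/
theorem negCnfSatS (m : CNFMatrix n) (hD : 16 ≤ D) (hB : 250 * (n * n) + 200 * n + 300 ≤ B) :
    BD D B (n * (clauseRowLines n + 126 * n + 2514 + 51) + 2254)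
      (disjList [neg (cnfForm m), satMatrixFormAt m]) := by
  rw [cnfForm_eq, satMatrixFormAt_eq]
  have hms := msum_cls_le m
  have hmr := msum_rows m
  have h := conjListMonoS (D := D) (B := B) (cls m) (rows m) (m₀ := clauseRowLines n) (p := 2)
    (fun Q hQ => by
      obtain ⟨i, -, rfl⟩ := List.mem_map.1 hQ
      exact ⟨_, List.mem_map.2 ⟨i, List.mem_finRange i, rfl⟩, negClauseRowS m i hD (by nlinarith)⟩)
    (fun X hX => by
      rcases List.mem_append.1 hX with hX | hX
      · obtain ⟨i, -, rfl⟩ := List.mem_map.1 hX; exact (dd_clause_le m i).trans (by norm_num)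
      · obtain ⟨i, -, rfl⟩ := List.mem_map.1 hX; exact dd_row_le m i)
    (by omega) (by nlinarith)
  rw [length_rows, length_cls] at h
  exact h

/-- `⊢ ¬SAT_n(m, Y), φ_m(Y)`. [folklore] -/
theorem negSatCnfS (m : CNFMatrix n) (hD : 16 ≤ D) (hB : 250 * (n * n) + 200 * n + 300 ≤ B) :
    BD D B (n * (rowClauseLines n + 126 * n + 2514 + 51) + 2254)
      (disjList [neg (satMatrixFormAt m), cnfForm m]) := by
  rw [cnfForm_eq, satMatrixFormAt_eq]
  have hms := msum_cls_le m
  have hmr := msum_rows m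
  have h := conjListMonoS (D := D) (B := B) (rows m) (cls m) (m₀ := rowClauseLines n) (p := 2)
    (fun Q hQ => by
      obtain ⟨i, -, rfl⟩ := List.mem_map.1 hQ
      exact ⟨_, List.mem_map.2 ⟨i, List.mem_finRange i, rfl⟩, negRowClauseS m i hD (by nlinarith)⟩)
    (fun X hX => by
      rcases List.mem_append.1 hX with hX | hX
      · obtain ⟨i, -, rfl⟩ := List.mem_map.1 hX; exact dd_row_le m i
      · obtain ⟨i, -, rfl⟩ := List.mem_map.1 hX; exact (dd_clause_le m i).trans (by norm_num))
    (by omega) (by nlinarith)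
  rw [length_rows, length_cls] at h
  exact h

/-- From the sequent `⊢ ¬a, b` to the formula `a → b` (`9` more lines). [folklore] -/
theorem implOfS {a b : PropForm ℕ} {ℓ p : ℕ} (h : BD D B ℓ (disjList [neg a, b]))
    (ha : (neg a).dd ≤ p) (hb : b.dd ≤ p) (hD : p + 3 ≤ D) (hs : 4 * (a.size + b.size) + 20 ≤ B) :
    BD D B (ℓ + 9) (impl a b) := by
  show BD D B (ℓ + 9) (disj (neg a) b)
  rw [disjList_cons, disjList_cons, disjList_nil] at h
  refine removeBotB (assocB h) ?_ ?_
  · rw [dd_neg, altDepthAux_one_disj]; omega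
  · simp only [size]; omega

/-! ### Budgets -/

/-- The size bound on the lines of the adequacy proofs: `250 n² + 200 n + 300`. [folklore] -/
def adequacyB (n : ℕ) : ℕ :=
  250 * (n * n) + 200 * n + 300

/-- The line budget of the adequacy proofs (an explicit polynomial of degree `5`,
`adequacyLines_le`). [folklore] -/
def adequacyLines (n : ℕ) : ℕ :=
  n * (clauseRowLines n + rowClauseLines n + 126 * n + 2514 + 51) + 2263

/-- `clauseRowLines n ≤ 106074 (n+1)⁴`. [folklore] -/
theorem clauseRowLines_le (n : ℕ) : clauseRowLines n ≤ 106074 * (n + 1) ^ 4 := by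
  have h1 : (n + 4 + 1) ^ 3 ≤ 125 * (n + 1) ^ 3 :=
    calc (n + 4 + 1) ^ 3 ≤ (5 * (n + 1)) ^ 3 := Nat.pow_le_pow_left (by omega) 3
      _ = 125 * (n + 1) ^ 3 := by ring
  have h2 : 2 * n * (3000 + 400 * (n + 4 + 1) ^ 3 + 35) ≤
      2 * (n + 1) * (3035 + 50000 * (n + 1) ^ 3) :=
    Nat.mul_le_mul (by omega) (by omega)
  have h3 : 2 * (n + 1) * (3035 + 50000 * (n + 1) ^ 3) = 6070 * (n + 1) + 100000 * (n + 1) ^ 4 := by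
    ring
  have h4 : n + 1 ≤ (n + 1) ^ 4 := Nat.le_self_pow (by norm_num) _
  unfold clauseRowLines
  omega

/-- `rowClauseLines n ≤ 103039 (n+1)⁴`. [folklore] -/
theorem rowClauseLines_le (n : ℕ) : rowClauseLines n ≤ 103039 * (n + 1) ^ 4 := by
  have h1 : (2 * n + 5) ^ 3 ≤ 125 * (n + 1) ^ 3 :=
    calc (2 * n + 5) ^ 3 ≤ (5 * (n + 1)) ^ 3 := Nat.pow_le_pow_left (by omega) 3
      _ = 125 * (n + 1) ^ 3 := by ring
  have h2 : n * (800 * (2 * n + 5) ^ 3 + 3000 + 35) ≤ (n + 1) * (100000 * (n + 1) ^ 3 + 3035) :=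
    Nat.mul_le_mul (by omega) (by omega)
  have h3 : (n + 1) * (100000 * (n + 1) ^ 3 + 3035) = 100000 * (n + 1) ^ 4 + 3035 * (n + 1) := by
    ring
  have h4 : n + 1 ≤ (n + 1) ^ 4 := Nat.le_self_pow (by norm_num) _
  unfold rowClauseLines
  omega

/-- **The line budget is a polynomial of degree `5`**: `adequacyLines n ≤ 250000 (n+1)⁵`.
[folklore] -/
theorem adequacyLines_le (n : ℕ) : adequacyLines n ≤ 250000 * (n + 1) ^ 5 := by
  have h1 := clauseRowLines_le n
  have h2 := rowClauseLines_le n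
  have h3 : n * (clauseRowLines n + rowClauseLines n + 126 * n + 2514 + 51) ≤
      (n + 1) * (209113 * (n + 1) ^ 4 + 126 * (n + 1) + 2565) :=
    Nat.mul_le_mul (by omega) (by omega)
  have h4 : (n + 1) * (209113 * (n + 1) ^ 4 + 126 * (n + 1) + 2565) =
      209113 * (n + 1) ^ 5 + 126 * ((n + 1) * (n + 1)) + 2565 * (n + 1) := by ring
  have h5 : (n + 1) * (n + 1) ≤ (n + 1) ^ 5 := by
    calc (n + 1) * (n + 1) = (n + 1) ^ 2 := by ring
      _ ≤ (n + 1) ^ 5 := Nat.pow_le_pow_right (by omega) (by norm_num)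
  have h6 : n + 1 ≤ (n + 1) ^ 5 := Nat.le_self_pow (by norm_num) _
  have h7 : 1 ≤ (n + 1) ^ 5 := Nat.one_le_pow _ _ (by omega)
  unfold adequacyLines
  linarith

/-- `adequacyB n ≤ 750 (n+1)²`. [folklore] -/
theorem adequacyB_le (n : ℕ) : adequacyB n ≤ 750 * (n + 1) ^ 2 := by
  unfold adequacyB; nlinarith

/-- The product of the two budgets (the proof SIZE bound) is at most `2·10⁸ (n+1)⁷`. [folklore] -/
theorem adequacyLines_mul_adequacyB_le (n : ℕ) :
    adequacyLines n * adequacyB n ≤ 2 * 10 ^ 8 * (n + 1) ^ 7 := by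
  calc adequacyLines n * adequacyB n ≤ (250000 * (n + 1) ^ 5) * (750 * (n + 1) ^ 2) :=
        Nat.mul_le_mul (adequacyLines_le n) (adequacyB_le n)
    _ = 187500000 * (n + 1) ^ 7 := by ring
    _ ≤ 2 * 10 ^ 8 * (n + 1) ^ 7 := Nat.mul_le_mul_right _ (by norm_num)

/-! ### The adequacy proofs -/

/-- Depth facts of the two sides. [folklore] -/
theorem dd_sides (m : CNFMatrix n) :
    (cnfForm m).dd ≤ 3 ∧ (neg (cnfForm m)).dd ≤ 4 ∧ (satMatrixFormAt m).dd ≤ 4 ∧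
      (neg (satMatrixFormAt m)).dd ≤ 5 := by
  refine ⟨dd_ofCNF_le _, dd_neg_ofCNF_le _, ?_, ?_⟩
  · rw [satMatrixFormAt_eq]
    exact dd_conjList_le (p := 2) fun X hX => by
      obtain ⟨i, -, rfl⟩ := List.mem_map.1 hX; exact dd_row_le m i
  · rw [satMatrixFormAt_eq]
    exact dd_neg_conjList_le (p := 2) fun X hX => by
      obtain ⟨i, -, rfl⟩ := List.mem_map.1 hX; exact dd_row_le m i

/-- Size facts of the two sides. [folklore] -/
theorem size_sides (m : CNFMatrix n) :
    (cnfForm m).size ≤ n * (6 * n + 2) + 1 ∧ (satMatrixFormAt m).size = n * (9 * n + 2) + 1 := by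
  rw [cnfForm_eq, satMatrixFormAt_eq, size_conjList_eq_msum, size_conjList_eq_msum, msum_rows]
  exact ⟨by have := msum_cls_le m; omega, rfl⟩

/-- **Adequacy, `φ_m(Y) → SAT_n(m, Y)`, as a bounded derivation**: at most `adequacyLines n` lines
of disjunct depth `≤ 16` and size `≤ adequacyB n`. [folklore] -/
theorem implCnfSatBD (m : CNFMatrix n) :
    BD 16 (adequacyB n) (adequacyLines n) (impl (cnfForm m) (satMatrixFormAt m)) := by
  obtain ⟨d1, d2, d3, d4⟩ := dd_sides m
  obtain ⟨s1, s2⟩ := size_sides m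
  have h := negCnfSatS (D := 16) (B := adequacyB n) m le_rfl (by unfold adequacyB; omega)
  have h2 := implOfS (p := 5) h (by omega) (by omega) (by norm_num) (by unfold adequacyB; nlinarith)
  refine h2.mono ?_
  have e : clauseRowLines n + 126 * n + 2514 + 51 ≤
      clauseRowLines n + rowClauseLines n + 126 * n + 2514 + 51 := by omega
  have := Nat.mul_le_mul_left n e
  unfold adequacyLines; linarith

/-- **Adequacy, `SAT_n(m, Y) → φ_m(Y)`, as a bounded derivation**: at most `adequacyLines n` lines
of disjunct depth `≤ 16` and size `≤ adequacyB n`. [folklore] -/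
theorem implSatCnfBD (m : CNFMatrix n) :
    BD 16 (adequacyB n) (adequacyLines n) (impl (satMatrixFormAt m) (cnfForm m)) := by
  obtain ⟨d1, d2, d3, d4⟩ := dd_sides m
  obtain ⟨s1, s2⟩ := size_sides m
  have h := negSatCnfS (D := 16) (B := adequacyB n) m le_rfl (by unfold adequacyB; omega)
  have h2 := implOfS (p := 5) h (by omega) (by omega) (by norm_num) (by unfold adequacyB; nlinarith)
  refine h2.mono ?_
  have e : rowClauseLines n + 126 * n + 2514 + 51 ≤
      clauseRowLines n + rowClauseLines n + 126 * n + 2514 + 51 := by omega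
  have := Nat.mul_le_mul_left n e
  unfold adequacyLines; linarith

/-- **Adequacy as a biimplication**: `SAT_n(m, Y) ↔ φ_m(Y)` (`PropForm.biimp`) in at most
`2 · adequacyLines n + 67` lines. [folklore] -/
theorem biimpBD (m : CNFMatrix n) :
    BD 16 (adequacyB n) (2 * adequacyLines n + 67) (biimp (satMatrixFormAt m) (cnfForm m)) := by
  obtain ⟨d1, d2, d3, d4⟩ := dd_sides m
  obtain ⟨s1, s2⟩ := size_sides m
  have hB : 120 * (n * n) + 32 * n + 100 ≤ adequacyB n := by unfold adequacyB; omega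
  have ha1 := altDepthAux_le_dd_succ 1 (cnfForm m)
  have ha2 := altDepthAux_le_dd_succ 1 (satMatrixFormAt m)
  have h1 : BD 16 (adequacyB n) (adequacyLines n) (disj (neg (satMatrixFormAt m)) (cnfForm m)) :=
    implSatCnfBD m
  have h2 : BD 16 (adequacyB n) (adequacyLines n) (disj (neg (cnfForm m)) (satMatrixFormAt m)) :=
    implCnfSatBD m
  have h3 : BD 16 (adequacyB n) (adequacyLines n + 2) (disj (satMatrixFormAt m) (neg (cnfForm m))) :=
    commB h2 (by rw [dd_neg, altDepthAux_one_neg]; omega) (by simp only [size]; nlinarith)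
  have u1 := unitS h1 (by norm_num) (by simp only [size]; nlinarith)
  have u3 := unitS h3 (by norm_num) (by simp only [size]; nlinarith)
  have c := consConjS (L := []) u1 u3 (by rw [dd_disj]; omega) (by rw [dd_disj, dd_neg]; omega)
    (by simp) (by simp only [size, disjList_nil]; nlinarith)
  rw [disjList_cons, disjList_nil] at c
  have fin := removeBotB c (by
      rw [dd_neg, altDepthAux_one_conj, altDepthAux_two_disj, altDepthAux_two_disj, dd_neg, dd_neg]
      omega) (by simp only [size]; nlinarith)
  exact fin.mono (by omega)

end SatMatrixFrege

/-! ### Statements for consumers -/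

open SatMatrixFrege

variable {n : ℕ}

/-- **Short Frege proofs of `φ_m(Y) → SAT_n(m, Y)`.** For every matrix code `m : CNFMatrix n`
there is a `textbookFrege` proof of `impl (cnfForm m) (satMatrixFormAt m)` of depth `≤ 17` and size
at most `adequacyLines n · adequacyB n ≤ 2·10⁸ (n+1)⁷` (`adequacyLines_mul_adequacyB_le`): the
direction used in Pich–Santhanam's p-boundedness step (from a refutation of `SAT_n(⌜φ⌝, Y)` to a
refutation of the clauses of `φ`). [cite: Krajicek1995, Lemma 9.3.12] [cite: PichSanthanam2026, §3.2 Thm 19 (proof)] -/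
theorem exists_proof_impl_cnfForm_satMatrixFormAt (m : CNFMatrix n) :
    ∃ π, textbookFrege.IsDepthProofOf 17 π (impl (cnfForm m) (satMatrixFormAt m)) ∧
      proofSize π ≤ adequacyLines n * adequacyB n :=
  (implCnfSatBD m).exists_isDepthProofOf

/-- **Short Frege proofs of `SAT_n(m, Y) → φ_m(Y)`**, same bounds. [cite: Krajicek1995, Lemma 9.3.12] -/
theorem exists_proof_impl_satMatrixFormAt_cnfForm (m : CNFMatrix n) :
    ∃ π, textbookFrege.IsDepthProofOf 17 π (impl (satMatrixFormAt m) (cnfForm m)) ∧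
      proofSize π ≤ adequacyLines n * adequacyB n :=
  (implSatCnfBD m).exists_isDepthProofOf

/-- **Short Frege proofs of the adequacy equivalence `SAT_n(m, Y) ↔ φ_m(Y)`** (`PropForm.biimp`):
depth `≤ 17`, size `≤ (2 · adequacyLines n + 67) · adequacyB n`. [cite: Krajicek1995, Lemma 9.3.12] -/
theorem exists_proof_biimp_satMatrixFormAt_cnfForm (m : CNFMatrix n) :
    ∃ π, textbookFrege.IsDepthProofOf 17 π (biimp (satMatrixFormAt m) (cnfForm m)) ∧
      proofSize π ≤ (2 * adequacyLines n + 67) * adequacyB n :=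
  (biimpBD m).exists_isDepthProofOf

/-- The same with the polynomial bound made explicit: a `textbookFrege` proof of
`φ_m(Y) → SAT_n(m, Y)` of size at most `2·10⁸ (n+1)⁷`. [cite: Krajicek1995, Lemma 9.3.12] -/
theorem exists_proof_impl_cnfForm_satMatrixFormAt_poly (m : CNFMatrix n) :
    ∃ π, textbookFrege.IsProofOf π (impl (cnfForm m) (satMatrixFormAt m)) ∧
      proofSize π ≤ 2 * 10 ^ 8 * (n + 1) ^ 7 := by
  obtain ⟨π, hπ, hs⟩ := exists_proof_impl_cnfForm_satMatrixFormAt m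
  exact ⟨π, hπ.isProofOf, hs.trans (adequacyLines_mul_adequacyB_le n)⟩

/-- And for the converse: a `textbookFrege` proof of `SAT_n(m, Y) → φ_m(Y)` of size at most
`2·10⁸ (n+1)⁷`. [cite: Krajicek1995, Lemma 9.3.12] -/
theorem exists_proof_impl_satMatrixFormAt_cnfForm_poly (m : CNFMatrix n) :
    ∃ π, textbookFrege.IsProofOf π (impl (satMatrixFormAt m) (cnfForm m)) ∧
      proofSize π ≤ 2 * 10 ^ 8 * (n + 1) ^ 7 := by
  obtain ⟨π, hπ, hs⟩ := exists_proof_impl_satMatrixFormAt_cnfForm m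
  exact ⟨π, hπ.isProofOf, hs.trans (adequacyLines_mul_adequacyB_le n)⟩

/-- **Adequacy for a coded CNF**: for `φ` in format `n` (code `⌜φ⌝ = CNFMatrix.ofCNF n φ`), a
`textbookFrege` proof of `φ_{⌜φ⌝}(Y) → SAT_n(⌜φ⌝, Y)` of size `≤ 2·10⁸ (n+1)⁷`, where
`φ_{⌜φ⌝}` is `φ` with normalised literal order and padding rows (`eval_toCNF_ofCNF`).
[cite: PichSanthanam2026, §3.2 Thm 19 (proof)] -/
theorem exists_proof_impl_cnfForm_satMatrixFormAt_ofCNF (n : ℕ) (φ : CNF ℕ) :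
    ∃ π, textbookFrege.IsProofOf π
        (impl (cnfForm (CNFMatrix.ofCNF n φ)) (satMatrixFormAt (CNFMatrix.ofCNF n φ))) ∧
      proofSize π ≤ 2 * 10 ^ 8 * (n + 1) ^ 7 :=
  exists_proof_impl_cnfForm_satMatrixFormAt_poly _


end Literature.Computability.MetaComplexity
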